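import Mathlib
import Summits.NavierStokesRegularity.NavierStokesRegularity.Theorems.FilamentSkeletonRssClause13PieceSup
import Summits.NavierStokesRegularity.NavierStokesRegularity.Theorems.FilamentSkeletonRssClause13ModelLowDirichlet

/-!
# Clause 13-J/13-R, brick m3b-T (SUP OF A WINDOW PIECE THROUGH THE WINDOW GAIN): `Gκ·‖P(x)‖² ≤ √(E_k·E_{k′})`

Route `FilamentSkeletonRss`, ∃-side clause 13 (`Clause13RNearStraightL`, stmt-NavierStokesRegularity-23612; typing-agnostic).  Design of record
rev 80–82 (m3b; tenure notes R-m3b-1/3: "in `X/√q ≤ |z| ≤ z₁` use the skew gain `2G/q·κ_M` with the frequency cap absorbing the transport term";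
lane remark "transition commutator via window gain + Bernstein").  The forcing of the far transport ODE (`norm_modelOperator_far_le`, p717403)
contains `Λ·‖P_T(x)‖` with the TRANSITION PIECE `P_T = (t k′+k)∗Y`, whose profile `−zχ′(z)` sits in a window where the symbol is one-signed of size
`≥ κ` (`κ = κ_M`, gain `Gκ ~ Γ`).  The plain Agmon/`L¹` bound `‖P(x)‖ ≤ √(‖g‖₁‖g′‖₁)·N(Y)` (`norm_piece_le_sqrt_mul_l2`, p711085) does not see this
gain; here the sup of ANY window piece is routed through the window estimate twice:
* §1 `transform_derivKernel` — the derivative kernel has profile `−iz·χ(z)` (so it lives in the same window); `model_pieceDeriv_window_estimate` —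
  the elliptic-window piece estimate (`model_piece_window_estimate`, p701338) for `P′ = k′∗Y`;
* §2 ★ `normSq_windowPiece_le` — for `k` real `C²` (bounded `k, k′`; `k, k′, k″, t k, t k′, t k″ ∈ L¹`) with profile in `{(2/q)𝔖 ≤ −κ}` or
  `{κ ≤ (2/q)𝔖}`, `κ > 0`, and `Y ∈ C¹_c`:  `G·κ·‖P(x)‖² ≤ √(E_k · E_{k′})` at every `x`, where
  `E_k = (‖k‖₁N(𝓛Y) + (Λ(‖t k′‖₁+‖k‖₁) + (L₁+L₂)‖t k‖₁ + (b₁+b₂)‖k‖₁ + √2Λ‖t k′‖₁)N(Y) + √2Λ‖k′‖₁N((τ−c)Y))·‖k‖₁·N(Y)` is the right side of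
  p701338 and `E_{k′}` the same with `k → k′` (Agmon `‖P(x)‖² ≤ N(P)N(P′)`, p711085, then both factors through the gain).
In the clause scaling (`Gκ_M ~ Γ`) this is the `Γ^{-1/2}`-sized sup bound of the transition piece in MODEL currency (`N(𝓛Y)`, `N(Y)`,
`N((τ−c)Y) ≤ R·N(Y)` on the right); the exchange to clause currency is the booked waist-localisation design point, not this file.
Lane ns-filament-19175-p1 g18; `--supports stmt-NavierStokesRegularity-23612 --as helper`.
HONEST FRAMING: bookkeeping about an explicit 1-D model operator attached to a HYPOTHETICAL filament skeleton on the NEGATIVE side of a MODEL route;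
nothing here bears on Navier–Stokes regularity or blow-up; 23610/23612 stay OPEN.
-/

noncomputable section

open MeasureTheory Real Complex Filter Set
open scoped ComplexConjugate Topology
open Summit.NavierStokesRegularity.NavierStokesRegularity.Theorems.AnalyticStripLiaSymbol (liaSym)

namespace Summit.NavierStokesRegularity.NavierStokesRegularity.Theorems.MatchedKernel
set_option linter.dupNamespace false

/-! ## §1 The derivative kernel lives in the same window -/

/-- **Profile of the derivative kernel**: if `∫k e^{izt}dt = χ(z)` (`k ∈ C¹`, `k, k′ ∈ L¹`) then `∫k′ e^{izt}dt = −iz·χ(z)`. [folklore] -/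
theorem transform_derivKernel {k k' : ℝ → ℝ} (hk : ∀ t, HasDerivAt k (k' t) t) (hki : Integrable k) (hk'i : Integrable k')
    {χ : ℝ → ℂ} (hkχ : ∀ z : ℝ, ∫ t : ℝ, ((k t : ℝ) : ℂ) * cexp (I * z * t) = χ z) (z : ℝ) :
    ∫ t : ℝ, ((k' t : ℝ) : ℂ) * cexp (I * z * t) = -(I * z) * χ z := by
  have h := unnormalisedTransform_deriv (f := fun t : ℝ => ((k t : ℝ) : ℂ)) (f' := fun t : ℝ => ((k' t : ℝ) : ℂ))
    (fun t => (hk t).ofReal_comp) hki.ofReal hk'i.ofReal z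
  rw [hkχ z] at h
  exact h

/-- **ELLIPTIC-WINDOW ESTIMATE FOR THE DERIVATIVE PIECE `P′ = k′∗Y`.**  Same statement as `model_piece_window_estimate` (p701338) for the kernel
`k′` (`k ∈ C²`: `k′` has continuous derivative `k″`; `k, k′, k″, t k′, t k″ ∈ L¹`, `k′` bounded), the window hypothesis being inherited from the
profile `χ` of `k` (the profile of `k′` is `−izχ(z)`). [folklore] -/
theorem model_pieceDeriv_window_estimate {q G κ : ℝ} (hq : 0 < q) (hG : 0 < G)
    {k k' k'' : ℝ → ℝ} (hk : ∀ t, HasDerivAt k (k' t) t) (hk' : ∀ t, HasDerivAt k' (k'' t) t) (hk''c : Continuous k'')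
    (hki : Integrable k) (hk'i : Integrable k') (hk''i : Integrable k'')
    (hk'1 : Integrable fun t => t * k' t) (hk''1 : Integrable fun t => t * k'' t) {Mk' : ℝ} (hk'M : ∀ t, |k' t| ≤ Mk')
    {χ : ℝ → ℂ} (hkχ : ∀ z : ℝ, ∫ t : ℝ, ((k t : ℝ) : ℂ) * cexp (I * z * t) = χ z)
    (hsym : (∀ z : ℝ, χ z ≠ 0 → 2 / q * liaSym (z * √q) ≤ -κ) ∨ (∀ z : ℝ, χ z ≠ 0 → κ ≤ 2 / q * liaSym (z * √q)))
    {Y : ℝ → ℂ} (hY : ContDiff ℝ 1 Y) (hYs : HasCompactSupport Y) (c : ℝ)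
    {w : ℝ → ℝ} (hw : Differentiable ℝ w) {Λ : ℝ} (hΛ : ∀ t, |deriv w t| ≤ Λ) (hwc : w c = 0)
    {β₁ β₂ : ℝ → ℂ} (hβ₁c : Continuous β₁) (hβ₂c : Continuous β₂) {b₁ b₂ L₁ L₂ : ℝ}
    (hb₁ : ∀ τ, ‖β₁ τ‖ ≤ b₁) (hb₂ : ∀ τ, ‖β₂ τ‖ ≤ b₂) (hL₁ : ∀ x y, ‖β₁ y - β₁ x‖ ≤ L₁ * |y - x|) (hL₂ : ∀ x y, ‖β₂ y - β₂ x‖ ≤ L₂ * |y - x|) :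
    G * κ * ∫ x : ℝ, ‖∫ y : ℝ, ((k' (x - y) : ℝ) : ℂ) * Y y‖ ^ 2
      ≤ ((∫ t, |k' t|) * (∫ y : ℝ, ‖I * (G : ℂ) * ((2 / q : ℂ) * Y y
              - ∫ σ : ℝ, ((((2 * q - (y - σ) ^ 2) * (((y - σ) ^ 2 + q) ^ (5 / 2 : ℝ))⁻¹ : ℝ)) : ℂ) * Y σ)
            - ((w y : ℝ) : ℂ) * deriv Y y + β₁ y * Y y + β₂ y * conj (Y y)‖ ^ 2) ^ (1 / 2 : ℝ)
          + (Λ * ((∫ t, |t| * |k'' t|) + ∫ t, |k' t|) + (L₁ + L₂) * (∫ t, |t| * |k' t|) + (b₁ + b₂) * (∫ t, |k' t|)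
              + Real.sqrt 2 * Λ * ∫ t, |t| * |k'' t|) * (∫ y : ℝ, ‖Y y‖ ^ 2) ^ (1 / 2 : ℝ)
          + Real.sqrt 2 * Λ * (∫ t, |k'' t|) * (∫ y : ℝ, ‖(((y - c : ℝ) : ℂ)) * Y y‖ ^ 2) ^ (1 / 2 : ℝ))
        * ((∫ t, |k' t|) * (∫ y : ℝ, ‖Y y‖ ^ 2) ^ (1 / 2 : ℝ)) := by
  have hkχ' : ∀ z : ℝ, ∫ t : ℝ, ((k' t : ℝ) : ℂ) * cexp (I * z * t) = (fun z : ℝ => -(I * z) * χ z) z :=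
    fun z => transform_derivKernel hk hki hk'i hkχ z
  have hsym' : (∀ z : ℝ, (fun z : ℝ => -(I * z) * χ z) z ≠ 0 → 2 / q * liaSym (z * √q) ≤ -κ) ∨
      (∀ z : ℝ, (fun z : ℝ => -(I * z) * χ z) z ≠ 0 → κ ≤ 2 / q * liaSym (z * √q)) := by
    rcases hsym with h | h
    · exact Or.inl fun z hz => h z (right_ne_zero_of_mul hz)
    · exact Or.inr fun z hz => h z (right_ne_zero_of_mul hz)
  exact model_piece_window_estimate hq hG hk' hk''c hk'i hk''i hk'1 hk''1 hk'M hkχ' hsym' hY hYs c hw hΛ hwc hβ₁c hβ₂c hb₁ hb₂ hL₁ hL₂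

/-! ## §2 The sup of a window piece through the gain -/

/-- From `g·A ≤ E₁`, `g·B ≤ E₂` (`g > 0`, `A, B ≥ 0`) and `s ≤ A^{1/2}·B^{1/2}`: `g·s ≤ √(E₁E₂)`. [folklore] -/
theorem gain_mul_le_sqrt_mul {g A B E₁ E₂ s : ℝ} (hg : 0 < g) (hA : 0 ≤ A) (hB : 0 ≤ B) (h1 : g * A ≤ E₁) (h2 : g * B ≤ E₂)
    (hs : s ≤ A ^ (1 / 2 : ℝ) * B ^ (1 / 2 : ℝ)) : g * s ≤ Real.sqrt (E₁ * E₂) := by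
  have hE₁ : 0 ≤ E₁ := le_trans (by positivity) h1
  have hE₂ : 0 ≤ E₂ := le_trans (by positivity) h2
  have hAB : A ^ (1 / 2 : ℝ) * B ^ (1 / 2 : ℝ) = Real.sqrt (A * B) := by
    rw [Real.sqrt_eq_rpow, Real.mul_rpow hA hB]
  rw [hAB] at hs
  have h3 : Real.sqrt (g ^ 2 * (A * B)) = g * Real.sqrt (A * B) := by
    rw [Real.sqrt_mul (sq_nonneg g), Real.sqrt_sq hg.le]
  have h4 : g ^ 2 * (A * B) = g * A * (g * B) := by ring
  calc g * s ≤ g * Real.sqrt (A * B) := mul_le_mul_of_nonneg_left hs hg.le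
    _ = Real.sqrt (g * A * (g * B)) := by rw [← h3, h4]
    _ ≤ Real.sqrt (E₁ * E₂) := Real.sqrt_le_sqrt (mul_le_mul h1 h2 (by positivity) hE₁)

/-- ★ **SUP OF A WINDOW PIECE THROUGH THE WINDOW GAIN.**  `q, G, κ > 0`; `k` real `C²` with `k, k′` bounded and `k, k′, k″, t k, t k′, t k″ ∈ L¹`,
profile `χ(z) = ∫k e^{izt}` supported where the symbol is one-signed of size `≥ κ` (`χ z ≠ 0 → (2/q)𝔖(z√q) ≤ −κ`, or `… ≥ κ`); `Y ∈ C¹_c`; slip and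
multipliers as in `model_piece_window_estimate`.  Then with `P = k∗Y`, `E_k` the right side of `model_piece_window_estimate` for `k` and `E_{k′}`
the one for `k′` (`model_pieceDeriv_window_estimate`), at every `x`:  `G·κ·‖P(x)‖² ≤ √(E_k · E_{k′})`. [folklore] -/
theorem normSq_windowPiece_le {q G κ : ℝ} (hq : 0 < q) (hG : 0 < G) (hκ : 0 < κ)
    {k k' k'' : ℝ → ℝ} (hk : ∀ t, HasDerivAt k (k' t) t) (hk' : ∀ t, HasDerivAt k' (k'' t) t) (hk''c : Continuous k'')
    (hki : Integrable k) (hk'i : Integrable k') (hk''i : Integrable k'')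
    (hk1 : Integrable fun t => t * k t) (hk'1 : Integrable fun t => t * k' t) (hk''1 : Integrable fun t => t * k'' t)
    {Mk Mk' : ℝ} (hkM : ∀ t, |k t| ≤ Mk) (hk'M : ∀ t, |k' t| ≤ Mk')
    {χ : ℝ → ℂ} (hkχ : ∀ z : ℝ, ∫ t : ℝ, ((k t : ℝ) : ℂ) * cexp (I * z * t) = χ z)
    (hsym : (∀ z : ℝ, χ z ≠ 0 → 2 / q * liaSym (z * √q) ≤ -κ) ∨ (∀ z : ℝ, χ z ≠ 0 → κ ≤ 2 / q * liaSym (z * √q)))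
    {Y : ℝ → ℂ} (hY : ContDiff ℝ 1 Y) (hYs : HasCompactSupport Y) (c : ℝ)
    {w : ℝ → ℝ} (hw : Differentiable ℝ w) {Λ : ℝ} (hΛ : ∀ t, |deriv w t| ≤ Λ) (hwc : w c = 0)
    {β₁ β₂ : ℝ → ℂ} (hβ₁c : Continuous β₁) (hβ₂c : Continuous β₂) {b₁ b₂ L₁ L₂ : ℝ}
    (hb₁ : ∀ τ, ‖β₁ τ‖ ≤ b₁) (hb₂ : ∀ τ, ‖β₂ τ‖ ≤ b₂) (hL₁ : ∀ x y, ‖β₁ y - β₁ x‖ ≤ L₁ * |y - x|) (hL₂ : ∀ x y, ‖β₂ y - β₂ x‖ ≤ L₂ * |y - x|)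
    (x : ℝ) :
    G * κ * ‖∫ y : ℝ, ((k (x - y) : ℝ) : ℂ) * Y y‖ ^ 2
      ≤ Real.sqrt (
        (((∫ t, |k t|) * (∫ y : ℝ, ‖I * (G : ℂ) * ((2 / q : ℂ) * Y y
              - ∫ σ : ℝ, ((((2 * q - (y - σ) ^ 2) * (((y - σ) ^ 2 + q) ^ (5 / 2 : ℝ))⁻¹ : ℝ)) : ℂ) * Y σ)
            - ((w y : ℝ) : ℂ) * deriv Y y + β₁ y * Y y + β₂ y * conj (Y y)‖ ^ 2) ^ (1 / 2 : ℝ)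
          + (Λ * ((∫ t, |t| * |k' t|) + ∫ t, |k t|) + (L₁ + L₂) * (∫ t, |t| * |k t|) + (b₁ + b₂) * (∫ t, |k t|)
              + Real.sqrt 2 * Λ * ∫ t, |t| * |k' t|) * (∫ y : ℝ, ‖Y y‖ ^ 2) ^ (1 / 2 : ℝ)
          + Real.sqrt 2 * Λ * (∫ t, |k' t|) * (∫ y : ℝ, ‖(((y - c : ℝ) : ℂ)) * Y y‖ ^ 2) ^ (1 / 2 : ℝ))
        * ((∫ t, |k t|) * (∫ y : ℝ, ‖Y y‖ ^ 2) ^ (1 / 2 : ℝ)))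
        *
        (((∫ t, |k' t|) * (∫ y : ℝ, ‖I * (G : ℂ) * ((2 / q : ℂ) * Y y
              - ∫ σ : ℝ, ((((2 * q - (y - σ) ^ 2) * (((y - σ) ^ 2 + q) ^ (5 / 2 : ℝ))⁻¹ : ℝ)) : ℂ) * Y σ)
            - ((w y : ℝ) : ℂ) * deriv Y y + β₁ y * Y y + β₂ y * conj (Y y)‖ ^ 2) ^ (1 / 2 : ℝ)
          + (Λ * ((∫ t, |t| * |k'' t|) + ∫ t, |k' t|) + (L₁ + L₂) * (∫ t, |t| * |k' t|) + (b₁ + b₂) * (∫ t, |k' t|)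
              + Real.sqrt 2 * Λ * ∫ t, |t| * |k'' t|) * (∫ y : ℝ, ‖Y y‖ ^ 2) ^ (1 / 2 : ℝ)
          + Real.sqrt 2 * Λ * (∫ t, |k'' t|) * (∫ y : ℝ, ‖(((y - c : ℝ) : ℂ)) * Y y‖ ^ 2) ^ (1 / 2 : ℝ))
        * ((∫ t, |k' t|) * (∫ y : ℝ, ‖Y y‖ ^ 2) ^ (1 / 2 : ℝ)))) := by
  have hkc : Continuous k := continuous_iff_continuousAt.2 fun t => (hk t).continuousAt
  have hk'c : Continuous k' := continuous_iff_continuousAt.2 fun t => (hk' t).continuousAt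
  have hYc := hY.continuous
  -- the piece, its derivative `P′ = k′∗Y`, both in `L²`
  have hPd : ∀ t : ℝ, HasDerivAt (fun x : ℝ => ∫ y : ℝ, ((k (x - y) : ℝ) : ℂ) * Y y) (∫ y : ℝ, ((k' (t - y) : ℝ) : ℂ) * Y y) t := by
    intro t
    have h := hasDerivAt_piece hkc hY hYs t
    rw [piece_deriv_eq_derivKernel_piece hk hk'c hY hYs t] at h
    exact h
  have hP'c : Continuous fun x : ℝ => ∫ y : ℝ, ((k' (x - y) : ℝ) : ℂ) * Y y := continuous_piece hk'c hYc hYs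
  have hP2 : MemLp (fun x : ℝ => ∫ y : ℝ, ((k (x - y) : ℝ) : ℂ) * Y y) 2 volume := memLp_piece hkc hki hYc hYs
  have hP'2 : MemLp (fun x : ℝ => ∫ y : ℝ, ((k' (x - y) : ℝ) : ℂ) * Y y) 2 volume := memLp_piece hk'c hk'i hYc hYs
  -- Agmon
  have hag := normSq_le_l2_mul_l2_deriv hPd hP'c hP2 hP'2 x
  -- the two window estimates
  have hE1 := model_piece_window_estimate hq hG hk hk'c hki hk'i hk1 hk'1 hkM hkχ hsym hY hYs c hw hΛ hwc hβ₁c hβ₂c hb₁ hb₂ hL₁ hL₂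
  have hE2 := model_pieceDeriv_window_estimate hq hG hk hk' hk''c hki hk'i hk''i hk'1 hk''1 hk'M hkχ hsym hY hYs c hw hΛ hwc hβ₁c hβ₂c
    hb₁ hb₂ hL₁ hL₂
  have hA : 0 ≤ ∫ x : ℝ, ‖∫ y : ℝ, ((k (x - y) : ℝ) : ℂ) * Y y‖ ^ 2 := integral_nonneg fun x => by positivity
  have hB : 0 ≤ ∫ x : ℝ, ‖∫ y : ℝ, ((k' (x - y) : ℝ) : ℂ) * Y y‖ ^ 2 := integral_nonneg fun x => by positivity
  exact gain_mul_le_sqrt_mul (mul_pos hG hκ) hA hB hE1 hE2 hag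

end Summit.NavierStokesRegularity.NavierStokesRegularity.Theorems.MatchedKernel

end
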